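import Summits.ValiantsHypothesis.ValiantsHypothesis.Theorems.MonotoneRestorationOrbitRestorationQPDepthThreeRungDefs
import Summits.ValiantsHypothesis.ValiantsHypothesis.Theorems.MonotoneRestorationOrbitRestorationQPRestorable
import Summits.ValiantsHypothesis.ValiantsHypothesis.Theorems.MonotoneRestorationOrbitRestorationQPEquivariantTermsTools
import HarnessLib

/-!
# Route MonotoneRestoration — crux `OrbitRestorationQP` (stmt-ValiantsHypothesis-18293), line `depth-three-rung`:
# THE TAME STRATUM OF `A_∞` IN THE REGISTERED (MULTISET) CURRENCY

The open stub `stub_sigmaPiSigmaValue` (A_∞) is kernel-equivalent to its explicit form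
(`ExplicitForm.sigmaPiSigmaValue_iff_explicit`, `…OrbitRestorationQPExplicitForm.lean`): restoration for
matrix-symmetric families given at every level as `f n = Σ_{i<k} C(a i) · Π (L i)`, `L i` multisets of `≤ n^c + c`
polynomials of total degree `≤ 1`.  The landed factor-multiset criterion
`ValueProducts.qpOrbitRestorable_of_affineProductTerms` (`…ValueOrbitProductTerms.lean`) is phrased with indexed
coefficient families `affineForm w₀ w s i` and TWO orbit hypotheses (forms and multisets).  This file restates it in
the registered currency, per level and for families, with the single natural hypothesis "every term's factor
MULTISET has quasi-polynomially many diagonal translates":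

* `ncard_orbit_mem_le` — a member of a multiset has at most (translates of the multiset) × (its cardinality)
  translates: the form-orbit hypothesis of the criterion follows from the multiset-orbit hypothesis;
* `orbit_budget` — the arithmetic `2^((log₂ n + c)^c) · (n^c + c) ≤ 2^((log₂ n + (2c+2))^(2c+2))`;
* `qpOrbitRestorable_of_tameTerms` — **TAME TERMS RESTORE (per level)**: a diagonally invariant
  `p = Σ_{i<k} C(a i) · Π (L i)` (any `k`), every `L i` a multiset of `≤ n^c + c` polynomials of total degree `≤ 1`
  with `≤ 2^((log₂ n + c)^c)` translates `(L i).map (ren σ)`, is `QPOrbitRestorable (2c + 7) n p`;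
* `explicit_sigmaPiSigmaValue_tame` — **THE TAME STRATUM OF EXPLICIT A_∞** (family form, one constant): the
  explicit form of the stub with the extra clause "every `L i` has `≤ 2^((log₂ n + c)^c)` translates" is PROVED.
  What remains of A_∞ is exactly the complement: representations containing, at infinitely many levels, a term
  whose factor multiset has super-quasi-polynomially many translates ("twisted" terms — small orbit of the
  PRODUCT, large orbit of the multiset — and "wild" terms — large orbit of the product itself, invariance only
  after summation).

Everything is proved; the stub stays open; VP ≠ VNP is not touched. [folklore]

## References
* A. Dawar, G. Wilsenach, *Symmetric arithmetic circuits*, ToC 21 (2025), §3.3 (ORB). [DawarWilsenach2025]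
-/

noncomputable section

open scoped Classical

-- `Summit.ValiantsHypothesis.ValiantsHypothesis.…` is the tree's single-conjunct layout (Sub = Summit).
set_option linter.dupNamespace false

namespace Summit.ValiantsHypothesis.ValiantsHypothesis.Theorems.OrbitRestorationQPDepthThreeRung

namespace TameStratum

open Literature.Computability.AlgebraicComplexity
open Equiv MvPolynomial

variable {n : ℕ}

/-! ### Members of a multiset have few translates if the multiset has -/

/-- **A member of a multiset has at most `(#translates of the multiset) · (cardinality)` translates** under the
diagonal renaming action: every translate `ren σ ℓ` of a member `ℓ ∈ M` is a member of the translate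
`M.map (ren σ)`. [folklore] -/
theorem ncard_orbit_mem_le (M : Multiset (MvPolynomial (Fin n × Fin n) ℂ))
    {ℓ : MvPolynomial (Fin n × Fin n) ℂ} (hℓ : ℓ ∈ M) :
    (Set.range fun σ : Perm (Fin n) => ren σ ℓ).ncard ≤
      (Set.range fun σ : Perm (Fin n) => M.map (ren σ)).ncard * Multiset.card M := by
  set R : Set (Multiset (MvPolynomial (Fin n × Fin n) ℂ)) := Set.range fun σ : Perm (Fin n) => M.map (ren σ)
    with hR
  have hRfin : R.Finite := Set.finite_range _
  set S : Finset (Multiset (MvPolynomial (Fin n × Fin n) ℂ)) := hRfin.toFinset with hS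
  have hsub : (Set.range fun σ : Perm (Fin n) => ren σ ℓ) ⊆ ↑(S.biUnion fun N => N.toFinset) := by
    rintro _ ⟨σ, rfl⟩
    simp only [Finset.coe_biUnion, Finset.mem_coe, Set.mem_iUnion, Multiset.mem_toFinset, exists_prop]
    refine ⟨M.map (ren σ), ?_, Multiset.mem_map.2 ⟨ℓ, hℓ, rfl⟩⟩
    rw [hS, Set.Finite.mem_toFinset]
    exact ⟨σ, rfl⟩
  calc (Set.range fun σ : Perm (Fin n) => ren σ ℓ).ncard
      ≤ (↑(S.biUnion fun N => N.toFinset) : Set _).ncard := Set.ncard_le_ncard hsub (Finset.finite_toSet _)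
    _ = (S.biUnion fun N => N.toFinset).card := Set.ncard_coe_finset _
    _ ≤ ∑ N ∈ S, N.toFinset.card := Finset.card_biUnion_le
    _ ≤ ∑ N ∈ S, Multiset.card M := by
        refine Finset.sum_le_sum fun N hN => ?_
        rw [hS, Set.Finite.mem_toFinset] at hN
        obtain ⟨σ, rfl⟩ := hN
        exact (Multiset.toFinset_card_le _).trans (by rw [Multiset.card_map])
    _ = S.card * Multiset.card M := by rw [Finset.sum_const, smul_eq_mul]
    _ = R.ncard * Multiset.card M := by rw [hS, ← Set.ncard_eq_toFinset_card R hRfin]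

/-! ### Arithmetic -/

/-- **Orbit budget**: `2^((log₂ n + c)^c) · (n^c + c) ≤ 2^((log₂ n + (2c+2))^(2c+2))`. [folklore] -/
theorem orbit_budget (n c : ℕ) :
    2 ^ ((Nat.log 2 n + c) ^ c) * (n ^ c + c) ≤ 2 ^ ((Nat.log 2 n + (2 * c + 2)) ^ (2 * c + 2)) := by
  rcases Nat.eq_zero_or_pos c with rfl | hc
  · have h : 1 ≤ (Nat.log 2 n + (2 * 0 + 2)) ^ (2 * 0 + 2) := Nat.one_le_pow _ _ (by omega)
    calc 2 ^ (Nat.log 2 n + 0) ^ 0 * (n ^ 0 + 0) = 2 ^ 1 := by simp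
      _ ≤ 2 ^ ((Nat.log 2 n + (2 * 0 + 2)) ^ (2 * 0 + 2)) := Nat.pow_le_pow_right (by norm_num) h
  have hL : n < 2 ^ (Nat.log 2 n + 1) := Nat.lt_pow_succ_log_self Nat.one_lt_two n
  generalize Nat.log 2 n = L at hL ⊢
  -- `n^c + c ≤ 2^((L+1) c + c)`
  have hadd : ∀ m d : ℕ, 2 ^ m + d ≤ 2 ^ (m + d) := by
    intro m d
    induction d with
    | zero => simp
    | succ d ih =>
      have h1 : 1 ≤ 2 ^ m := Nat.one_le_two_pow
      calc 2 ^ m + (d + 1) ≤ 2 * (2 ^ m + d) := by omega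
        _ ≤ 2 * 2 ^ (m + d) := Nat.mul_le_mul_left 2 ih
        _ = 2 ^ (m + (d + 1)) := by ring
  have hpoly : n ^ c + c ≤ 2 ^ ((L + 1) * c + c) := by
    have h1 : n ^ c ≤ 2 ^ ((L + 1) * c) := by
      calc n ^ c ≤ (2 ^ (L + 1)) ^ c := Nat.pow_le_pow_left hL.le c
        _ = 2 ^ ((L + 1) * c) := (pow_mul 2 (L + 1) c).symm
    exact (Nat.add_le_add_right h1 c).trans (hadd _ _)
  -- exponent arithmetic: `(L+c)^c + ((L+1)c + c) ≤ (L + 2c + 2)^(2c+2)`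
  set B := L + (2 * c + 2) with hB
  have hB2 : 2 ≤ B := by omega
  have h1 : (L + c) ^ c ≤ B ^ (2 * c + 1) :=
    (Nat.pow_le_pow_left (by omega) c).trans (Nat.pow_le_pow_right (by omega) (by omega))
  have h2 : (L + 1) * c + c ≤ B ^ (2 * c + 1) := by
    calc (L + 1) * c + c = c * (L + 2) := by ring
      _ ≤ B * B := Nat.mul_le_mul (by omega) (by omega)
      _ = B ^ 2 := (sq B).symm
      _ ≤ B ^ (2 * c + 1) := Nat.pow_le_pow_right (by omega) (by omega)
  have hexp : (L + c) ^ c + ((L + 1) * c + c) ≤ B ^ (2 * c + 2) := by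
    calc (L + c) ^ c + ((L + 1) * c + c) ≤ B ^ (2 * c + 1) + B ^ (2 * c + 1) := Nat.add_le_add h1 h2
      _ = 2 * B ^ (2 * c + 1) := by ring
      _ ≤ B * B ^ (2 * c + 1) := Nat.mul_le_mul_right _ hB2
      _ = B ^ (2 * c + 2) := by ring
  calc 2 ^ ((L + c) ^ c) * (n ^ c + c) ≤ 2 ^ ((L + c) ^ c) * 2 ^ ((L + 1) * c + c) :=
        Nat.mul_le_mul_left _ hpoly
    _ = 2 ^ ((L + c) ^ c + ((L + 1) * c + c)) := (pow_add 2 _ _).symm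
    _ ≤ 2 ^ B ^ (2 * c + 2) := Nat.pow_le_pow_right (by norm_num) hexp

/-! ### Enumerating a padded multiset -/

/-- Enumerating a list of length `D` by `Fin D` with a default recovers the list. [folklore] -/
theorem ofFn_getD_eq {α : Type*} (l : List α) (d : α) {D : ℕ} (hl : l.length = D) :
    List.ofFn (fun j : Fin D => l.getD j d) = l := by
  subst hl
  apply List.ext_getElem (by simp)
  intro i h₁ h₂
  rw [List.getElem_ofFn]
  exact List.getD_eq_getElem l d h₂

/-! ### Tame terms restore -/

/-- **TAME TERMS RESTORE (per level).**  A diagonally invariant `p = Σ_{i<k} C(a i) · Π (L i)` on the `n × n`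
matrix, every `L i` a multiset of at most `n^c + c` polynomials of total degree `≤ 1` whose translates
`(L i).map (ren σ)`, `σ ∈ Sym(Fin n)`, number at most `2^((log₂ n + c)^c)`, is `QPOrbitRestorable (2c + 7) n p`
— whatever the number `k` of terms.  (Pad every `L i` with constant forms `1` to a common length, enumerate, and
apply `ValueProducts.qpOrbitRestorable_of_affineProductTerms`; the form-orbit hypothesis there follows from
`ncard_orbit_mem_le` and `orbit_budget`.) [folklore; cite: DawarWilsenach2025, §3.3] -/
theorem qpOrbitRestorable_of_tameTerms (c : ℕ) {p : MvPolynomial (Fin n × Fin n) ℂ} {k : ℕ} (a : Fin k → ℂ)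
    (L : Fin k → Multiset (MvPolynomial (Fin n × Fin n) ℂ))
    (hdeg : ∀ i, ∀ ℓ ∈ L i, ℓ.totalDegree ≤ 1) (hcard : ∀ i, Multiset.card (L i) ≤ n ^ c + c)
    (horb : ∀ i, (Set.range fun σ : Perm (Fin n) => (L i).map (ren σ)).ncard ≤ 2 ^ ((Nat.log 2 n + c) ^ c))
    (hp : p = ∑ i, MvPolynomial.C (a i) * (L i).prod) (hinv : ∀ σ : Perm (Fin n), ren σ p = p) :
    QPOrbitRestorable (2 * c + 7) n p := by
  -- padded multisets and their enumerations
  set D : ℕ := n ^ c + c with hD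
  let M : Fin k → Multiset (MvPolynomial (Fin n × Fin n) ℂ) :=
    fun i => L i + Multiset.replicate (D - Multiset.card (L i)) (MvPolynomial.C 1)
  have hMcard : ∀ i, Multiset.card (M i) = D := by
    intro i
    simp only [M, Multiset.card_add, Multiset.card_replicate]
    have := hcard i; omega
  have hMdeg : ∀ i, ∀ ℓ ∈ M i, ℓ.totalDegree ≤ 1 := by
    intro i ℓ hℓ
    rcases Multiset.mem_add.1 hℓ with h | h
    · exact hdeg i ℓ h
    · rw [Multiset.eq_of_mem_replicate h, MvPolynomial.totalDegree_C]; exact zero_le_one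
  have hMprod : ∀ i, (M i).prod = (L i).prod := by
    intro i
    simp only [M, Multiset.prod_add, Multiset.prod_replicate, map_one, one_pow, mul_one]
  have hMmap : ∀ i (σ : Perm (Fin n)), (M i).map (ren σ) =
      (L i).map (ren σ) + Multiset.replicate (D - Multiset.card (L i)) (MvPolynomial.C 1) := by
    intro i σ
    simp only [M, Multiset.map_add, Multiset.map_replicate, ren_C]
  let φ : Fin k → Fin D → MvPolynomial (Fin n × Fin n) ℂ := fun i j => (M i).toList.getD j (MvPolynomial.C 1)
  have hφM : ∀ i, (Finset.univ : Finset (Fin D)).val.map (φ i) = M i := by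
    intro i
    rw [Fin.univ_val_map]
    have hlen : (M i).toList.length = D := by rw [Multiset.length_toList, hMcard]
    rw [ofFn_getD_eq _ _ hlen, Multiset.coe_toList]
  have hφmem : ∀ i j, φ i j ∈ M i := by
    intro i j
    have : φ i j ∈ (Finset.univ : Finset (Fin D)).val.map (φ i) :=
      Multiset.mem_map.2 ⟨j, Finset.mem_univ_val j, rfl⟩
    rwa [hφM i] at this
  have hφdeg : ∀ i j, (φ i j).totalDegree ≤ 1 := fun i j => hMdeg i _ (hφmem i j)
  -- coefficient data
  let w₀ : Fin k → Fin D → ℂ := fun i j => MvPolynomial.coeff 0 (φ i j)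
  let w : Fin k → Fin D → (Fin n × Fin n) → ℂ := fun i j x => MvPolynomial.coeff (Finsupp.single x 1) (φ i j)
  have hform : ∀ i j, ValueProducts.affineForm w₀ w i j = φ i j := by
    intro i j
    rw [ValueProducts.affineForm]
    exact (eqvTerms_affine_eq (φ i j) (hφdeg i j)).symm
  have hformM : ∀ i, (Finset.univ : Finset (Fin D)).val.map (ValueProducts.affineForm w₀ w i) = M i := by
    intro i
    rw [show ValueProducts.affineForm w₀ w i = φ i from funext (hform i)]
    exact hφM i
  -- the two orbit budgets
  set c' : ℕ := 2 * c + 2 with hc'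
  have hBmono : 2 ^ ((Nat.log 2 n + c) ^ c) ≤ 2 ^ ((Nat.log 2 n + c') ^ c') := by
    refine le_trans ?_ (orbit_budget n c)
    refine Nat.le_mul_of_pos_right _ ?_
    rcases Nat.eq_zero_or_pos c with rfl | hc
    · simp
    · positivity
  have hmultM : ∀ i, (Set.range fun σ : Perm (Fin n) => (M i).map (ren σ)).ncard ≤
      2 ^ ((Nat.log 2 n + c) ^ c) := by
    intro i
    have heq : (Set.range fun σ : Perm (Fin n) => (M i).map (ren σ)) =
        (fun N => N + Multiset.replicate (D - Multiset.card (L i)) (MvPolynomial.C 1)) ''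
          (Set.range fun σ : Perm (Fin n) => (L i).map (ren σ)) := by
      rw [← Set.range_comp]
      exact congrArg Set.range (funext fun σ => hMmap i σ)
    rw [heq]
    exact (Set.ncard_image_le (Set.finite_range _)).trans (horb i)
  refine ValueProducts.qpOrbitRestorable_of_affineProductTerms (c := c') w₀ w a ?_ ?_ ?_ hinv
  · -- form orbits
    intro i j
    rw [hform i j]
    calc (Set.range fun σ : Perm (Fin n) => ren σ (φ i j)).ncard
        ≤ (Set.range fun σ : Perm (Fin n) => (M i).map (ren σ)).ncard * Multiset.card (M i) :=
          ncard_orbit_mem_le (M i) (hφmem i j)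
      _ ≤ 2 ^ ((Nat.log 2 n + c) ^ c) * (n ^ c + c) := Nat.mul_le_mul (hmultM i) (by rw [hMcard i])
      _ ≤ 2 ^ ((Nat.log 2 n + c') ^ c') := orbit_budget n c
  · -- multiset orbits
    intro i
    rw [hformM i]
    exact (hmultM i).trans hBmono
  · -- the value
    rw [hp]
    refine Finset.sum_congr rfl fun i _ => ?_
    rw [Finset.prod_eq_multiset_prod, hformM i, hMprod i]

/-- **THE TAME STRATUM OF EXPLICIT `A_∞` (family form).**  Every matrix-symmetric family given at every level as
`f n = Σ_{i<k} C(a i) · Π (L i)` with `L i` multisets of `≤ n^c + c` polynomials of total degree `≤ 1`, each with at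
most `2^((log₂ n + c)^c)` diagonal translates, is quasi-polynomially orbit-restorable (constant `2c + 7`).  This is
the explicit form of the registered stub `stub_sigmaPiSigmaValue` (cf. `ExplicitForm.sigmaPiSigmaValue_iff_explicit`)
with the tameness clause added; the `PDClass` envelope and the bound on `k` are not needed.
[folklore; cite: DawarWilsenach2025, §3.3] -/
theorem explicit_sigmaPiSigmaValue_tame :
    ∀ f : (n : ℕ) → MvPolynomial (Fin n × Fin n) ℂ, IsMatrixSymmetric f →
      (∃ c : ℕ, ∀ n : ℕ,
        ∃ (k : ℕ) (a : Fin k → ℂ) (L : Fin k → Multiset (MvPolynomial (Fin n × Fin n) ℂ)),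
          (∀ i, ∀ ℓ ∈ L i, ℓ.totalDegree ≤ 1) ∧ (∀ i, Multiset.card (L i) ≤ n ^ c + c) ∧
          (∀ i, (Set.range fun σ : Perm (Fin n) => (L i).map (ren σ)).ncard ≤ 2 ^ ((Nat.log 2 n + c) ^ c)) ∧
          f n = ∑ i, MvPolynomial.C (a i) * (L i).prod) →
      ∃ c : ℕ, ∀ n : ℕ, QPOrbitRestorable c n (f n) := by
  rintro f hsym ⟨c, hc⟩
  refine ⟨2 * c + 7, fun n => ?_⟩
  obtain ⟨k, a, L, hdeg, hcard, horb, hfn⟩ := hc n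
  have hinv : ∀ σ : Perm (Fin n), ren σ (f n) = f n := fun σ => hsym n σ σ
  exact qpOrbitRestorable_of_tameTerms c a L hdeg hcard horb hfn hinv

end TameStratum

end Summit.ValiantsHypothesis.ValiantsHypothesis.Theorems.OrbitRestorationQPDepthThreeRung

end
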